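import Mathlib
import HarnessLib
import Summits.CriticalPhenomena.SAWScalingLimit.Theses.SAWDefectDecoherence
import Literature.Probability.RandomPlanarGeometry.HexSAWStrip
import Literature.Probability.RandomPlanarGeometry.HexSAWLowerBound
import Literature.Probability.RandomPlanarGeometry.HexSAWLemma2
import Literature.Probability.RandomPlanarGeometry.HexSAWBridgeDecay

/-!
# Module — `pinched-double-bridge-gain` (crux MassRatio, stmt-CriticalPhenomena-8550), crux-plan gen 2

The idea supplies a MODULE, not a line to `MassRatio` (see `Lines/pinched-double-bridge-gain.md`):
its one open stub is `IntersectionGain` (DCS's cutting inequality (6) improved by `(T+1)^{-κ}`,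
`κ > 0`), and everything downstream of it is glue, CERTIFIED here sorry-free:

* `intersectionGainLim_of : IntersectionGain → IntersectionGainLim` (pass to `sup_L`, as the
  tree's `stripAlim_succ_le`);
* `tailLower_of : StripIdentity → IntersectionGainLim → TailLower` (DCS's induction run with the
  gain; Bernoulli's inequality replaces the harmonic-sum estimate; output exponent `min κ (1/2)`);
* `tailLower_of_gain : StripIdentity → IntersectionGain → TailLower`.

`StripIdentity` (`1 = c_α A_T + B_T`, i.e. `E_T = 0`) is a cite fact (Beaton–Bousquet-Mélou–de
Gier–Duminil-Copin–Guttmann, arXiv:1109.0358 Prop. 9 at `y = 1`); the tree has it only under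
`Summable …` (`stripElim_eq_zero`).  No statement here reaches `MassRatio`.
-/

namespace Summit.CriticalPhenomena.SAWScalingLimit.Cruxes.MassRatio.PinchedDoubleBridgeGain

open Literature.Probability.LatticeModels Literature.Probability.RandomPlanarGeometry.SAW

/-- StripIdentity (`E_T = 0`): `1 = c_α A_T + B_T` for every `T ≥ 1` (arXiv:1109.0358 Prop. 9,
`y = 1`; KP23/GM20 restate it).  Cite fact, not proved in the tree unconditionally. -/
def StripIdentity : Prop :=
  ∀ T : ℕ, 1 ≤ T → (1 : ℝ) = Real.cos (3 * Real.pi / 8) * HV.stripAlim T + HV.stripBlim T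

/-- IntersectionGain (finite strips; verbatim `IdeatorThreeSketch.IntersectionGain`): the cutting
inequality `HV.stripA_succ_le` improved by the factor `C (T+1)^{-κ}`, `κ > 0` — the pinched pair of
bridges produced by the cut is mutually avoiding, and avoidance costs a power.  THE open stub. -/
def IntersectionGain : Prop :=
  ∃ κ C : ℝ, 0 < κ ∧ ∀ T L : ℕ, 1 ≤ T →
    HV.stripA (T + 1) L hexCriticalFugacity ≤ HV.stripA T L hexCriticalFugacity +
      C * ((T : ℝ) + 1) ^ (-κ) * hexCriticalFugacity⁻¹ *
        (HV.stripB (T + 1) L hexCriticalFugacity * HV.stripB (T + 1) (2 * L) hexCriticalFugacity)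

/-- IntersectionGainLim: the `sup_L` form consumed by the recursion. -/
def IntersectionGainLim : Prop :=
  ∃ κ C : ℝ, 0 < κ ∧ ∀ T : ℕ, 1 ≤ T →
    HV.stripAlim (T + 1) ≤ HV.stripAlim T +
      C * ((T : ℝ) + 1) ^ (-κ) * hexCriticalFugacity⁻¹ * HV.stripBlim (T + 1) ^ 2

/-- StrictGain (κ-free first bite, finite enumeration at the corner): a fixed fraction `η` of the
product mass is lost to the pinch, uniformly in `T ≥ 1`, `L`. -/
def StrictGain : Prop :=
  ∃ η : ℝ, 0 < η ∧ ∀ T L : ℕ, 1 ≤ T →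
    HV.stripA (T + 1) L hexCriticalFugacity ≤ HV.stripA T L hexCriticalFugacity +
      (1 - η) * hexCriticalFugacity⁻¹ *
        (HV.stripB (T + 1) L hexCriticalFugacity * HV.stripB (T + 1) (2 * L) hexCriticalFugacity)

/-- TailLower (the module's output): `B_T ≥ c T^{-(1-κ)}` for some `κ > 0` — a boundary tail below
the random-walk value `c/T` of DCS Remark 2 (predicted `T^{-1/4}`). -/
def TailLower : Prop :=
  ∃ κ c : ℝ, 0 < κ ∧ 0 < c ∧ ∀ T : ℕ, 1 ≤ T → c * (T : ℝ) ^ (-(1 - κ)) ≤ HV.stripBlim T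

/-! ### Glue, certified -/

/-- Passing to `sup_L` in the gain inequality (as `stripAlim_succ_le`). -/
theorem intersectionGainLim_of (h : IntersectionGain) : IntersectionGainLim := by
  obtain ⟨κ, C, hκ, hg⟩ := h
  refine ⟨κ, max C 0, hκ, fun T hT => ?_⟩
  have hlem := DuminilCopinSmirnov2012_lemma2_holds
  have h0 := hexCriticalFugacity_pos_lt_one.1
  refine ciSup_le fun L => (hg T L hT).trans ?_
  have hA := stripA_le_lim hlem hT L
  have hB1 := stripB_le_lim hlem (T := T + 1) (by omega) L
  have hB2 := stripB_le_lim hlem (T := T + 1) (by omega) (2 * L)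
  have hBn1 : 0 ≤ HV.stripB (T + 1) L hexCriticalFugacity := HV.stripB_nonneg h0.le
  have hBn2 : 0 ≤ HV.stripB (T + 1) (2 * L) hexCriticalFugacity := HV.stripB_nonneg h0.le
  have hprod : HV.stripB (T + 1) L hexCriticalFugacity * HV.stripB (T + 1) (2 * L) hexCriticalFugacity
      ≤ HV.stripBlim (T + 1) ^ 2 := by
    rw [sq]; exact mul_le_mul hB1 hB2 hBn2 (hBn1.trans hB1)
  have hpow : 0 ≤ ((T : ℝ) + 1) ^ (-κ) := Real.rpow_nonneg (by positivity) _
  have hinv : 0 ≤ hexCriticalFugacity⁻¹ := inv_nonneg.2 h0.le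
  have hcoef : 0 ≤ max C 0 * ((T : ℝ) + 1) ^ (-κ) * hexCriticalFugacity⁻¹ :=
    mul_nonneg (mul_nonneg (le_max_right _ _) hpow) hinv
  have hstep1 : C * ((T : ℝ) + 1) ^ (-κ) * hexCriticalFugacity⁻¹ *
        (HV.stripB (T + 1) L hexCriticalFugacity * HV.stripB (T + 1) (2 * L) hexCriticalFugacity)
      ≤ max C 0 * ((T : ℝ) + 1) ^ (-κ) * hexCriticalFugacity⁻¹ *
        (HV.stripB (T + 1) L hexCriticalFugacity * HV.stripB (T + 1) (2 * L) hexCriticalFugacity) :=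
    mul_le_mul_of_nonneg_right
      (mul_le_mul_of_nonneg_right (mul_le_mul_of_nonneg_right (le_max_left _ _) hpow) hinv)
      (mul_nonneg hBn1 hBn2)
  have hstep2 : max C 0 * ((T : ℝ) + 1) ^ (-κ) * hexCriticalFugacity⁻¹ *
        (HV.stripB (T + 1) L hexCriticalFugacity * HV.stripB (T + 1) (2 * L) hexCriticalFugacity)
      ≤ max C 0 * ((T : ℝ) + 1) ^ (-κ) * hexCriticalFugacity⁻¹ * HV.stripBlim (T + 1) ^ 2 :=
    mul_le_mul_of_nonneg_left hprod hcoef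
  linarith

/-- The Bernoulli step of the induction: `M t^{1-κ} + K (t+1)^{-κ} ≤ M (t+1)^{1-κ}` for `t ≥ 1`
whenever `K ≤ M (1-κ)`, `0 ≤ κ ≤ 1`. -/
theorem bern_step {M K κ t : ℝ} (hM : 0 ≤ M) (hκ0 : 0 ≤ κ) (hκ1 : κ ≤ 1)
    (hKM : K ≤ M * (1 - κ)) (ht : 1 ≤ t) :
    M * t ^ (1 - κ) + K * (t + 1) ^ (-κ) ≤ M * (t + 1) ^ (1 - κ) := by
  have ht0 : 0 < t := by linarith
  have hu0 : 0 < t + 1 := by linarith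
  have hb : (1 + t⁻¹) ^ κ ≤ 1 + κ * t⁻¹ :=
    rpow_one_add_le_one_add_mul_self (by have := inv_nonneg.2 ht0.le; linarith) hκ0 hκ1
  have hsplit : (t + 1) ^ κ = t ^ κ * (1 + t⁻¹) ^ κ := by
    rw [← Real.mul_rpow ht0.le (by positivity)]
    congr 1
    field_simp
  have h1 : t ^ (1 - κ) * (t + 1) ^ κ ≤ t + κ := by
    rw [hsplit, ← mul_assoc, ← Real.rpow_add ht0, show (1 - κ) + κ = 1 by ring, Real.rpow_one]
    calc t * (1 + t⁻¹) ^ κ ≤ t * (1 + κ * t⁻¹) := mul_le_mul_of_nonneg_left hb ht0.le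
      _ = t + κ := by field_simp
  have hQ : 0 ≤ (t + 1) ^ (-κ) := Real.rpow_nonneg hu0.le _
  have hPQ : (t + 1) ^ κ * (t + 1) ^ (-κ) = 1 := by
    rw [← Real.rpow_add hu0, add_neg_cancel, Real.rpow_zero]
  have e1 : (t + 1) ^ (1 - κ) = (t + 1) * (t + 1) ^ (-κ) := by
    rw [sub_eq_add_neg, Real.rpow_add hu0, Real.rpow_one]
  have e2 : M * t ^ (1 - κ) + K * (t + 1) ^ (-κ) =
      (M * (t ^ (1 - κ) * (t + 1) ^ κ) + K) * (t + 1) ^ (-κ) := by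
    rw [add_mul, mul_assoc M, mul_assoc (t ^ (1 - κ)), hPQ, mul_one]
  rw [e2, e1, show M * ((t + 1) * (t + 1) ^ (-κ)) = (M * (t + 1)) * (t + 1) ^ (-κ) from
    (mul_assoc _ _ _).symm]
  refine mul_le_mul_of_nonneg_right ?_ hQ
  have h2 : M * (t ^ (1 - κ) * (t + 1) ^ κ) ≤ M * (t + κ) := mul_le_mul_of_nonneg_left h1 hM
  nlinarith [h2, hKM]

/-- DCS's induction run with the gain: `StripIdentity → IntersectionGainLim → TailLower`
(output exponent `κ' = min κ (1/2)`). -/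
theorem tailLower_of (hid : StripIdentity) (hgain : IntersectionGainLim) : TailLower := by
  obtain ⟨κ, C, hκ, hg⟩ := hgain
  have hx0 : 0 < hexCriticalFugacity := hexCriticalFugacity_pos_lt_one.1
  have hcα : 0 < Real.cos (3 * Real.pi / 8) := cos_three_pi_div_eight_pos
  -- exponents and constants
  set κ' : ℝ := min κ (1 / 2) with hκ'
  have hκ'0 : 0 < κ' := lt_min hκ (by norm_num)
  have hκ'κ : κ' ≤ κ := min_le_left _ _
  have hκ'h : κ' ≤ 1 / 2 := min_le_right _ _
  have hCC' : C ≤ max C 0 := le_max_left _ _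
  have hC'0 : 0 ≤ max C 0 := le_max_right _ _
  have hB1 : 0 < HV.stripBlim 1 := stripBlim_one_pos DuminilCopinSmirnov2012_lemma2_holds
  have hBnn : ∀ T, 1 ≤ T → 0 ≤ HV.stripBlim T := fun T hT =>
    (HV.stripB_nonneg (T := T) (L := 0) hx0.le).trans
      (stripB_le_lim DuminilCopinSmirnov2012_lemma2_holds hT 0)
  -- one step of the recursion: B_T ≤ B_{T+1} + K (T+1)^{-κ} B_{T+1}²
  have hstep : ∀ T, 1 ≤ T → HV.stripBlim T ≤ HV.stripBlim (T + 1) +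
      Real.cos (3 * Real.pi / 8) * max C 0 * hexCriticalFugacity⁻¹ * ((T : ℝ) + 1) ^ (-κ) *
        HV.stripBlim (T + 1) ^ 2 := by
    intro T hT
    have h1 := hid T hT
    have h2 := hid (T + 1) (by omega)
    have h3 := hg T hT
    have hpow : 0 ≤ ((T : ℝ) + 1) ^ (-κ) := Real.rpow_nonneg (by positivity) _
    have hinv : 0 ≤ hexCriticalFugacity⁻¹ := inv_nonneg.2 hx0.le
    have hB2 : 0 ≤ HV.stripBlim (T + 1) ^ 2 := sq_nonneg _
    have h4 : C * ((T : ℝ) + 1) ^ (-κ) * hexCriticalFugacity⁻¹ * HV.stripBlim (T + 1) ^ 2 ≤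
        max C 0 * ((T : ℝ) + 1) ^ (-κ) * hexCriticalFugacity⁻¹ * HV.stripBlim (T + 1) ^ 2 :=
      mul_le_mul_of_nonneg_right
        (mul_le_mul_of_nonneg_right (mul_le_mul_of_nonneg_right hCC' hpow) hinv) hB2
    have h5 : HV.stripAlim (T + 1) - HV.stripAlim T ≤
        max C 0 * ((T : ℝ) + 1) ^ (-κ) * hexCriticalFugacity⁻¹ * HV.stripBlim (T + 1) ^ 2 := by
      linarith
    have h6 : Real.cos (3 * Real.pi / 8) * HV.stripAlim (T + 1) -
        Real.cos (3 * Real.pi / 8) * HV.stripAlim T ≤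
        Real.cos (3 * Real.pi / 8) *
          (max C 0 * ((T : ℝ) + 1) ^ (-κ) * hexCriticalFugacity⁻¹ * HV.stripBlim (T + 1) ^ 2) := by
      rw [← mul_sub]; exact mul_le_mul_of_nonneg_left h5 hcα.le
    have e : Real.cos (3 * Real.pi / 8) * max C 0 * hexCriticalFugacity⁻¹ * ((T : ℝ) + 1) ^ (-κ) *
        HV.stripBlim (T + 1) ^ 2 = Real.cos (3 * Real.pi / 8) *
          (max C 0 * ((T : ℝ) + 1) ^ (-κ) * hexCriticalFugacity⁻¹ * HV.stripBlim (T + 1) ^ 2) := by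
      ring
    rw [e]
    linarith
  -- the constants of the induction
  set K : ℝ := Real.cos (3 * Real.pi / 8) * max C 0 * hexCriticalFugacity⁻¹ with hK
  have hK0 : 0 ≤ K := mul_nonneg (mul_nonneg hcα.le hC'0) (inv_nonneg.2 hx0.le)
  set M : ℝ := max (HV.stripBlim 1)⁻¹ (2 * K) with hM
  have hM0 : 0 < M := lt_max_of_lt_left (inv_pos.2 hB1)
  have hKM : K ≤ M * (1 - κ') := by
    have : 2 * K ≤ M := le_max_right _ _
    nlinarith
  -- main claim
  have hmain : ∀ T, 1 ≤ T →
      0 < HV.stripBlim T ∧ (HV.stripBlim T)⁻¹ ≤ M * (T : ℝ) ^ (1 - κ') := by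
    intro T hT
    induction T, hT using Nat.le_induction with
    | base =>
      refine ⟨hB1, ?_⟩
      simp only [Nat.cast_one, Real.one_rpow, mul_one]
      exact le_max_left _ _
    | succ T hT ih =>
      obtain ⟨hpos, hbd⟩ := ih
      have hst := hstep T hT
      have hT1 : (1 : ℝ) ≤ T := by exact_mod_cast hT
      have hu0 : 0 < (T : ℝ) + 1 := by positivity
      set B := HV.stripBlim T with hB
      set B' := HV.stripBlim (T + 1) with hB'
      set Q : ℝ := ((T : ℝ) + 1) ^ (-κ) with hQ
      have hQ0 : 0 ≤ Q := Real.rpow_nonneg hu0.le _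
      have hB'nn : 0 ≤ B' := hBnn (T + 1) (by omega)
      have hpos' : 0 < B' := by
        rcases hB'nn.lt_or_eq with h | h
        · exact h
        · exfalso
          rw [← h] at hst
          simp at hst
          linarith
      refine ⟨hpos', ?_⟩
      push_cast
      by_cases hcase : B ≤ B'
      · calc B'⁻¹ ≤ B⁻¹ := inv_anti₀ hpos hcase
          _ ≤ M * (T : ℝ) ^ (1 - κ') := hbd
          _ ≤ M * ((T : ℝ) + 1) ^ (1 - κ') :=
            mul_le_mul_of_nonneg_left
              (Real.rpow_le_rpow (by positivity) (by linarith) (by linarith)) hM0.le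
      · push Not at hcase
        have h7 : B ≤ B' + K * Q * B * B' := by
          have hKQ : 0 ≤ K * Q := mul_nonneg hK0 hQ0
          have : K * Q * B' ^ 2 ≤ K * Q * B * B' := by
            calc K * Q * B' ^ 2 = K * Q * (B' * B') := by rw [sq]
              _ ≤ K * Q * (B * B') :=
                mul_le_mul_of_nonneg_left (mul_le_mul_of_nonneg_right hcase.le hB'nn) hKQ
              _ = K * Q * B * B' := by ring
          linarith
        have hBne : B ≠ 0 := hpos.ne'
        have hB'ne : B' ≠ 0 := hpos'.ne'
        have hkey : B'⁻¹ ≤ B⁻¹ + K * Q := by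
          have hBB' : 0 < B * B' := mul_pos hpos hpos'
          rw [← sub_nonneg]
          have e : B⁻¹ + K * Q - B'⁻¹ = (B' + K * Q * B * B' - B) / (B * B') := by
            field_simp
          rw [e]
          exact div_nonneg (by linarith) hBB'.le
        have hQ' : Q ≤ ((T : ℝ) + 1) ^ (-κ') :=
          Real.rpow_le_rpow_of_exponent_le (by linarith) (by linarith)
        calc B'⁻¹ ≤ B⁻¹ + K * Q := hkey
          _ ≤ M * (T : ℝ) ^ (1 - κ') + K * ((T : ℝ) + 1) ^ (-κ') :=
            add_le_add hbd (mul_le_mul_of_nonneg_left hQ' hK0)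
          _ ≤ M * ((T : ℝ) + 1) ^ (1 - κ') :=
            bern_step hM0.le hκ'0.le (by linarith) hKM hT1
  -- conclusion
  refine ⟨κ', M⁻¹, hκ'0, inv_pos.2 hM0, fun T hT => ?_⟩
  obtain ⟨hpos, hbd⟩ := hmain T hT
  have hT0 : (0 : ℝ) ≤ T := by positivity
  calc M⁻¹ * (T : ℝ) ^ (-(1 - κ')) = (M * (T : ℝ) ^ (1 - κ'))⁻¹ := by
        rw [Real.rpow_neg hT0, mul_inv]
    _ ≤ ((HV.stripBlim T)⁻¹)⁻¹ := inv_anti₀ (inv_pos.2 hpos) hbd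
    _ = HV.stripBlim T := inv_inv _

/-- The module's glue end to end: the cite fact and the one open stub give the tail. -/
theorem tailLower_of_gain (hid : StripIdentity) (hgain : IntersectionGain) : TailLower :=
  tailLower_of hid (intersectionGainLim_of hgain)

/-- For the record: the crux decl a LINE would have had to conclude, by name. Nothing in this
module reaches it (see the line card). -/
example : Prop := Summit.CriticalPhenomena.SAWScalingLimit.Theses.SAWDefectDecoherence.MassRatio

end Summit.CriticalPhenomena.SAWScalingLimit.Cruxes.MassRatio.PinchedDoubleBridgeGain
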